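import Literature.Topology.FourManifolds.KirbyCalculus
import Literature.Topology.FourManifolds.KirbyMovesStrictHandleSlide
import Literature.Topology.FourManifolds.KirbyMovesMirrorProofs
import HarnessLib

/-!
# SPC4 S23 over strict Kirby equivalence: Kirby's theorem, corrected statements

Sibling file of `Literature/Topology/FourManifolds/KirbyCalculus.lean` (family `spc4`, item S23 —
Kirby's theorem on framed links). The three S23 named facts there,
`Literature.Topology.FourManifolds.nonempty_diffeomorph_iff_kirbyEquivalent_or_mirror`,
`Literature.Topology.FourManifolds.nonempty_diffeomorph_of_kirbyEquivalent` and
`Literature.Topology.FourManifolds.nonempty_diffeomorph_of_kirbyEquivalent_mirror`, are stated over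
the tree's `Literature.Topology.FourManifolds.KirbyEquivalent` (`KirbyMoves.lean`), whose handle-slide
constructor `FramedLink.IsHandleSlide` is **more permissive than the printed move**: it lets the band
pass between the component `Kⱼ` and its framing push-off (through the collar annulus
`Knot.TubularNbhd.collar ν`), which is not a slide of the 2-handle and can change the surgered
3-manifold. Consequently the "if" direction over `KirbyEquivalent` is false as stated — one
permissive "slide" takes the `(0, 1)`-framed split two-component unlink (surgery `S² × S¹`) to a
framed link whose surgery is `S³₀(6₁)` (module docstring of `KirbyMovesStrictHandleSlide.lean`,
where the corrected move `FramedLink.IsStrictHandleSlide`, the corrected calculus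
`StrictKirbyMove` / `StrictKirbyEquivalent` and the corrected easy direction
`StrictKirbyEquivalent.nonempty_diffeomorph` are vendored) — and so are the first two S23 facts,
while the third inherits the false "←" direction. Nothing in `KirbyCalculus.lean` is edited; this
file states S23 over the faithful relation `StrictKirbyEquivalent`:

* `Literature.Topology.FourManifolds.nonempty_diffeomorph_iff_strictKirbyEquivalent_or_mirror` —
  **Kirby's theorem** (named fact, D-0014): surgeries on `L`, `L'` are diffeomorphic iff `L'` is
  strictly Kirby equivalent to `L` or to its mirror image `L̄` (framings negated). Kirby (1978),
  Thm 1, proves `∂M_L ≅ ∂M_{L'}` *orientation-preservingly* iff `L ~ L'`; the tree's surgery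
  predicate `FramedLink.IsSurgery` forgets the orientation inherited from `S³`, and reversing it is
  mirroring the framed link (`FramedLink.isSurgery_mirror_iff`, proved as
  `FramedLink.isSurgery_mirror_iff_holds`), whence the mirror disjunct — exactly as in the
  original S23 docstring (example there: `L(3,1)` from `(unknot, ±3)`).
* `Literature.Topology.FourManifolds.nonempty_diffeomorph_of_strictKirbyEquivalent_mirror` (PROVED
  from the corrected easy direction `StrictKirbyEquivalent.nonempty_diffeomorph` taken as a
  hypothesis, and the proved mirror lemma): if `L'̄ ~ L` strictly then the surgeries are
  diffeomorphic; and `Literature.Topology.FourManifolds.nonempty_diffeomorph_of_strictKirbyEquivalent_or_mirror`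
  (PROVED, same hypothesis): the "←" direction of the corrected S23.

The corrected easy direction itself needs no restatement: it *is*
`StrictKirbyEquivalent.nonempty_diffeomorph` (assembled from its leaves by the proved
`StrictKirbyEquivalent.nonempty_diffeomorph_of_leaves`). The hard direction ("→": Cerf theory,
Kirby (1978) §2–§3; Juhász (2023), proof of Thm 6.4) is not in the tree. Faithfulness of
`StrictKirbyEquivalent` to Kirby's calculus: Kirby's move (1) of 1978 is the blow-up/down of an
unknotted `±1`-framed circle separated from the rest of the link (`FramedLink.IsBlowDown`: the
deleted component bounds a disc missing the others), move (2) is the handle slide = band sum with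
the framing push-off along a band outside a tubular neighbourhood of `Kⱼ` containing the parallel
copy (`FramedLink.IsStrictHandleSlide`, up to the isotopies that `StrictKirbyMove.isotopy`
provides); renumbering and reversing components are immaterial for Kirby's unordered, unoriented
links.

## References

* R. Kirby, *A calculus for framed links in `S³`*, Invent. Math. 45 (1978), 35–56, Thm 1.
  [cite: Kirby1978, Thm 1]
* R. E. Gompf, A. I. Stipsicz, *4-Manifolds and Kirby Calculus* (1999), §5.1 (mirror image and
  orientation reversal), Thm 5.3.6. [cite: GompfStipsicz1999, Thm 5.3.6]
* R. C. Kirby, *The Topology of 4-Manifolds*, LNM 1374 (1989), Ch. I §4 (p. 10), §5 Thm 5.1.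
  [cite: Kirby1989, Ch. I §5 Thm 5.1]
* A. Juhász, *Differential and Low-Dimensional Topology* (2023), §6.1, moves (i), (ii), Thm 6.4.
  [cite: Juhasz2023, §6.1 Thm 6.4]
-/

open scoped Manifold ContDiff Topology
open Function Set

noncomputable section

namespace Literature.Topology.FourManifolds

section SPC4

universe u v

/-- Local notation: `𝔼 n` is the model Euclidean space `EuclideanSpace ℝ (Fin n)`. -/
local notation "𝔼 " n:arg => EuclideanSpace ℝ (Fin n)

variable [SphereEmbedding.SmoothnessFacts] [Knot.TubularNbhd.SmoothnessFacts]

/-- **spc4.S23, corrected — Kirby's theorem** (Kirby, Invent. Math. 45 (1978), Thm 1;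
Gompf–Stipsicz (1999), Thm 5.3.6; Juhász (2023), Thm 6.4). Let `Y`, `Y'` be closed connected
smooth 3-manifolds which are surgery on the framed links `L`, `L'` in `S³`
(`FramedLink.IsSurgery (𝓡 3)`). Then `Y` and `Y'` are diffeomorphic iff `L'` is *strictly* Kirby
equivalent (`StrictKirbyEquivalent`: isotopies, renumberings, reversals of components, blow-ups /
blow-downs of split `±1`-framed unknots, and handle slides along bands missing the collar between
the slid-over component and its push-off — the printed calculus) to `L` **or to the mirror image
`L̄` of `L` with negated framings** (`FramedLinkFin.mirror`). Kirby's theorem proper is the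
orientation-preserving statement `S³_L ≅⁺ S³_{L'} ↔ L ~ L'`; the surgery predicate forgets the
orientation inherited from `S³`, and reversing it corresponds to mirroring the framed link
(`FramedLink.isSurgery_mirror_iff_holds`), whence the disjunction (e.g. `(unknot, 3)` and
`(unknot, -3)` give `L(3,1)` and `-L(3,1)`, diffeomorphic but not orientation-preservingly, and
are not Kirby equivalent). This replaces `nonempty_diffeomorph_iff_kirbyEquivalent_or_mirror` of
`KirbyCalculus.lean`, stated over the coarser `KirbyEquivalent` and false in the "←" direction
(module docstring). Named fact (D-0014); the "←" direction follows from
`StrictKirbyEquivalent.nonempty_diffeomorph` (`nonempty_diffeomorph_of_strictKirbyEquivalent_or_mirror`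
below), the "→" direction is Kirby's theorem proper (Cerf theory). [cite: Kirby1978, Thm 1] -/
def nonempty_diffeomorph_iff_strictKirbyEquivalent_or_mirror : Prop :=
  ∀ (L L' : FramedLinkFin) (Y : Type u) (Y' : Type v) [TopologicalSpace Y] [T2Space Y]
    [SecondCountableTopology Y] [ChartedSpace (𝔼 3) Y] [IsManifold (𝓡 3) ∞ Y] [CompactSpace Y]
    [ConnectedSpace Y] [TopologicalSpace Y'] [T2Space Y'] [SecondCountableTopology Y']
    [ChartedSpace (𝔼 3) Y'] [IsManifold (𝓡 3) ∞ Y'] [CompactSpace Y'] [ConnectedSpace Y']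
    (_hY : L.2.IsSurgery (𝓡 3) Y) (_hY' : L'.2.IsSurgery (𝓡 3) Y'),
    Nonempty (Y ≃ₘ⟮𝓡 3, 𝓡 3⟯ Y') ↔ StrictKirbyEquivalent L L' ∨ StrictKirbyEquivalent L L'.mirror

/-- **spc4.S23, corrected, mirror form of the easy direction** (proved from the corrected easy
direction `StrictKirbyEquivalent.nonempty_diffeomorph`, taken as the hypothesis `h`, and the
proved mirror lemma `FramedLink.isSurgery_mirror_iff_holds`): if `L` is strictly Kirby equivalent
to the mirror image `L̄'` of `L'` (framings negated), then any surgery `Y` on `L` and any surgery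
`Y'` on `L'` are diffeomorphic as unoriented manifolds — `Y'` is also surgery on `L̄'`
(Gompf–Stipsicz (1999), §5.1: mirroring the diagram and negating the framings reverses the
orientation), so the easy direction applies to `L ~ L̄'`. Replaces
`nonempty_diffeomorph_of_kirbyEquivalent_mirror` of `KirbyCalculus.lean` (stated over the coarser
`KirbyEquivalent`, false as stated). [cite: GompfStipsicz1999, §5.1] -/
theorem nonempty_diffeomorph_of_strictKirbyEquivalent_mirror
    (h : StrictKirbyEquivalent.nonempty_diffeomorph.{u, v}) {L L' : FramedLinkFin}
    (hK : StrictKirbyEquivalent L L'.mirror) {Y : Type u} {Y' : Type v} [TopologicalSpace Y]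
    [T2Space Y] [SecondCountableTopology Y] [ChartedSpace (𝔼 3) Y] [IsManifold (𝓡 3) ∞ Y]
    [TopologicalSpace Y'] [T2Space Y'] [SecondCountableTopology Y'] [ChartedSpace (𝔼 3) Y']
    [IsManifold (𝓡 3) ∞ Y'] (hY : L.2.IsSurgery (𝓡 3) Y) (hY' : L'.2.IsSurgery (𝓡 3) Y') :
    Nonempty (Y ≃ₘ⟮𝓡 3, 𝓡 3⟯ Y') := by
  refine h hK hY ?_
  obtain ⟨n, L'⟩ := L'
  exact (FramedLink.isSurgery_mirror_iff_holds L').2 hY'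

/-- **spc4.S23, corrected, "←" direction** (proved from the corrected easy direction
`StrictKirbyEquivalent.nonempty_diffeomorph` taken as the hypothesis `h`): if `L'` is strictly
Kirby equivalent to `L` or to its mirror image, then surgeries on `L` and `L'` are diffeomorphic —
the "if" half of `nonempty_diffeomorph_iff_strictKirbyEquivalent_or_mirror`. The first case is `h`
itself, the second is `nonempty_diffeomorph_of_strictKirbyEquivalent_mirror`. Kirby (1978), Thm 1
"if"; Gompf–Stipsicz (1999), §5.1, Thm 5.3.6. [cite: Kirby1978, Thm 1 "if"] -/
theorem nonempty_diffeomorph_of_strictKirbyEquivalent_or_mirror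
    (h : StrictKirbyEquivalent.nonempty_diffeomorph.{u, v}) {L L' : FramedLinkFin}
    (hK : StrictKirbyEquivalent L L' ∨ StrictKirbyEquivalent L L'.mirror) {Y : Type u} {Y' : Type v}
    [TopologicalSpace Y] [T2Space Y] [SecondCountableTopology Y] [ChartedSpace (𝔼 3) Y]
    [IsManifold (𝓡 3) ∞ Y] [TopologicalSpace Y'] [T2Space Y'] [SecondCountableTopology Y']
    [ChartedSpace (𝔼 3) Y'] [IsManifold (𝓡 3) ∞ Y'] (hY : L.2.IsSurgery (𝓡 3) Y)
    (hY' : L'.2.IsSurgery (𝓡 3) Y') : Nonempty (Y ≃ₘ⟮𝓡 3, 𝓡 3⟯ Y') := by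
  rcases hK with hK | hK
  · exact h hK hY hY'
  · exact nonempty_diffeomorph_of_strictKirbyEquivalent_mirror h hK hY hY'

/-- Strict Kirby equivalence to `L'` or to its mirror image implies the corresponding statement
for the coarser `KirbyEquivalent` of `KirbyMoves.lean` (every strict move is a move); so the
right-hand side of the corrected S23 implies that of the original
`nonempty_diffeomorph_iff_kirbyEquivalent_or_mirror`. [folklore] -/
theorem kirbyEquivalent_or_mirror_of_strict {L L' : FramedLinkFin}
    (hK : StrictKirbyEquivalent L L' ∨ StrictKirbyEquivalent L L'.mirror) :
    KirbyEquivalent L L' ∨ KirbyEquivalent L L'.mirror :=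
  hK.imp StrictKirbyEquivalent.kirbyEquivalent StrictKirbyEquivalent.kirbyEquivalent

end SPC4

end Literature.Topology.FourManifolds
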